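import Literature.AnabelianGeometry.EtaleTheta.SettingModelTateDeckLevels
import Literature.AnabelianGeometry.EtaleTheta.SettingModelChiSectionPoints
import Literature.AnabelianGeometry.EtaleTheta.SettingModelKummerCocycleContinuous
import Literature.AnabelianGeometry.EtaleTheta.EtaleThetaDataOfClass
import HarnessLib

/-!
# The STAGE-2 («Tate shear») model of [EtTh] §1 (R78): Galois-section POINTS of `Ÿ(K̈)` at `modelχq` — twisted sections,
# the anchor `log(Ü)|_y = Ü(y)`, and the census tokens `EtaleThetaData` / `NonCuspidalPoint` / `AnchoredPoint`

S. Mochizuki, *The étale theta function and its Frobenioid-theoretic manifestations*, Publ. RIMS **45** (2009)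
[EtTh], §1, Prop. 1.4 (iii) p. 22 (values at non-cuspidal `K̈`-points), Prop. 1.5 p. 23 ("`log(Ü)`"), Def. 1.9 p. 29
(the points `τ^{±1}`) [cite: MochizukiEtTh2009, Prop 1.4 (iii) p.22]. Layer L2 of the abc-iut cell, seat abc-iut-L2-t6
(gen 6), R78 cluster hand #4 — the stage-2 twin of this seat's F7b (`SettingModelChiSectionPoints` /
`SettingModelChiAnchoredPoints`), over abc-iut-L2-t5's F5q `ThetaSetting.modelχq p i j hj` (`actχq`, `actχq_bPowGfp`,
`fixingSubgroup_fieldKN_qModel_two_eq_top`), abc-iut-w5-d171's F6q `kummerCoreχq` (`log(Ü) = c^{ŷ/2}`), abc-iut-L2-t5's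
F3c-2 (`kummerZH`), and this seat's generic `Semidirect.sectionOfCrossedHom` / `KummerCore.anchoredPointOfSections` /
`nonCuspidalPointOfCoreSection` — consumed BY NAME, nothing restated. GENERIC IN THE BASE SECTION `s` of the datum
(`inr` once abc-iut-L6-d5's section lemmas land; any continuous section of the augmentation inside `Π^tp_Ÿ` works).
Class (b) CONSTRUCTION (definitions `sectionχq`, `kappaUnitχq`, `sectionOfUnitχq`, `anchoredPointχqOfSection`; no
instance, no notation, no `Prop` fact).

WHAT. The shear does not act on the `b`-axis (`actχq σ (b^t) = b^{χ(σ)t}`), so exactly as at `modelχ`: a `χ`-cocycle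
`f` gives a continuous section `sectionχq f : σ ↦ ⟨b^{f σ}, σ⟩` inside `Π^tp_Y`, inside `Π^tp_Ÿ` when `f = k·k`; for a
unit `u ∈ K̈^× = ℚ_p^×` the `κ_u²`-twisted section `sectionOfUnitχq u` has `ŷ = κ_u²` along it, hence the core's
`log(Ü) = c^{ŷ/2}` pulls back to `κ(u)` — the ANCHOR `hanch` (`comap_sectionOfUnitχq_logUdd`, on the nose), giving
**`anchoredPointχqOfSection s … u hu : AnchoredPoint ((kummerCoreχq …).toKummerDataOfSection s …)`**. Since
`K̈(modelχq) = K̈(modelχ) = ℚ_p(±1, ±p)`, the coordinate `1 + p` of F7b (`onePlusP`, off the cusps) serves again: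
CENSUS TOKENS «EtaleThetaData / NonCuspidalPoint / AnchoredPoint → WITNESSED at modelχq» (the latter two for the section
datum of any Galois section `s`).

HONEST FRAMING: SEMI-SYNTHETIC model — consistency / non-vacuity evidence for the typed interface ONLY; values at
section-points are not the printed `Θ̈(Ü(y))`; nothing of [EtTh] is asserted; typed ≠ proved; no side is taken on
[IUTchIII] Cor. 3.12.
-/

noncomputable section

namespace Literature.AnabelianGeometry.EtaleTheta.SettingModel

open Literature.AnabelianGeometry.SemiGraphs _root_.Topology _root_.Function

variable (p : ℕ) [Fact p.Prime] (i j : ℤ)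

/-! ### Twisted sections of the stage-2 augmentation -/

/-- **The `b`-axis section of `Π^tp_X = Γ ⋊_{actχq} G_{ℚ_p}` twisted by a `χ`-cocycle** `f` (`f(στ) = f(σ)·χ(σ)(f(τ))`):
`σ ↦ ⟨b^{f σ}, σ⟩` — a homomorphism because the affine action fixes the `b`-axis up to `χ` (`actχq_bPowGfp`).
[cite: MochizukiEtTh2009, Prop 1.4 (iii) p.22] -/
def sectionχq (f : GQp p → ZH) (hf : ∀ σ τ : GQp p, f (σ * τ) = f σ * chi p σ (f τ)) : GQp p →* PiTpχq p i j :=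
  Semidirect.sectionOfCrossedHom (fun σ => bPowGfp (f σ)) fun σ τ => by
    rw [hf, map_mul, actχq_bPowGfp, cocyclePairHom_right]

variable (f : GQp p → ZH) (hf : ∀ σ τ : GQp p, f (σ * τ) = f σ * chi p σ (f τ))

/-- [cite: MochizukiEtTh2009, Prop 1.4 (iii) p.22] -/
@[simp] theorem sectionχq_left (σ : GQp p) : (sectionχq p i j f hf σ).left = bPowGfp (f σ) := rfl

/-- [cite: MochizukiEtTh2009, Prop 1.4 (iii) p.22] -/
@[simp] theorem sectionχq_right (σ : GQp p) : (sectionχq p i j f hf σ).right = σ := rfl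

/-- `aug ∘ sectionχq f = id` at `modelχq`. [cite: MochizukiEtTh2009, Prop 1.4 (iii) p.22] -/
theorem aug_modelχq_sectionχq (hj : Even j) (σ : GQp p) :
    (ThetaSetting.modelχq p i j hj).aug (sectionχq p i j f hf σ) = σ := rfl

/-- Continuity of the twisted section for continuous `f`. [cite: MochizukiEtTh2009, Prop 1.4 (iii) p.22] -/
theorem continuous_sectionχq (hfc : Continuous f) : Continuous (sectionχq p i j f hf) :=
  Semidirect.continuous_sectionOfCrossedHom (isInducing_leftRightχq p i j) _ _ (bPowGfp.continuous.comp hfc)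

/-- Twisted sections land in `Π^tp_Y` (degree `0`). [cite: MochizukiEtTh2009, Prop 1.4 (iii) p.22] -/
theorem sectionχq_mem_GtpY_modelχq (hj : Even j) (σ : GQp p) :
    sectionχq p i j f hf σ ∈ (ThetaSetting.modelχq p i j hj).GtpY := by
  show (tateTwistData₀ p i j).toZ _ = 1
  rw [GfpTwistData₀.toZ_apply, sectionχq_left, gfpSnd_bPowGfp]

/-- A section twisted by a SQUARE `k·k` lands in `Π^tp_Ÿ` of `modelχq` (level-`2` `y`-coordinate `2k ≡ 0`).
[cite: MochizukiEtTh2009, Def 1.9 p.29] -/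
theorem sectionχq_sq_mem_GtpYdd_modelχq (hj : Even j) {k : GQp p → ZH}
    (hkk : ∀ σ τ : GQp p, (k * k) (σ * τ) = (k * k) σ * chi p σ ((k * k) τ)) (σ : GQp p) :
    sectionχq p i j (k * k) hkk σ ∈ (ThetaSetting.modelχq p i j hj).GtpYdd := by
  refine mem_GtpYdd_modelχq_of_hHat_two_y p i j hj (sectionχq_mem_GtpY_modelχq p i j _ hkk hj σ) ?_
  rw [sectionχq_left, gfpFst_bPowGfp, hHat_bPow]
  change Multiplicative.toAdd (ZHatLevel.level 2 (k σ * k σ)) = 0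
  rw [map_mul, toAdd_mul, ← two_nsmul, nsmul_eq_mul]
  have h2 : ((2 : ℕ) : ZMod (2 : ℕ+)) = 0 := by decide
  rw [h2, zero_mul]

/-- [cite: MochizukiEtTh2009, Def 1.9 p.29] -/
theorem map_sectionχq_sq_GKdd_le_GtpYdd_modelχq (hj : Even j) {k : GQp p → ZH}
    (hkk : ∀ σ τ : GQp p, (k * k) (σ * τ) = (k * k) σ * chi p σ ((k * k) τ)) :
    (ThetaSetting.modelχq p i j hj).GKdd.map (sectionχq p i j (k * k) hkk) ≤ (ThetaSetting.modelχq p i j hj).GtpYdd := by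
  rintro _ ⟨σ, -, rfl⟩
  exact sectionχq_sq_mem_GtpYdd_modelχq p i j hj hkk σ

/-! ### The Kummer cocycle of a unit `u ∈ K̈^× = ℚ_p^×` and the `κ_u²`-twisted section -/

/-- A unit of `K̈(modelχq)` read in `ℚ̄_p^×` through the stage-2 core's `toInvYdd`. [cite: MochizukiEtTh2009, Prop 1.5 p.23] -/
abbrev unitχq (hj : Even j) (u : (↥(ThetaSetting.modelχq p i j hj).Kdd)ˣ) : (PadicAlgCl p)ˣ :=
  (((kummerCoreχq p i j hj).toInvYdd u : (kummerCoreχq p i j hj).invYdd) : (PadicAlgCl p)ˣ)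

/-- `u ∈ K̈^× = ℚ_p^×` is fixed by `G_{ℚ_p}` (`G_K̈ = G_{ℚ_p}` at the stage-2 model). [cite: MochizukiEtTh2009, §1 p.17] -/
theorem unitχq_mem_fixedPoints (hj : Even j) (u : (↥(ThetaSetting.modelχq p i j hj).Kdd)ˣ) :
    unitχq p i j hj u ∈ MulAction.fixedPoints (⊤ : Subgroup (GQp p)) (PadicAlgCl p)ˣ :=
  mem_fixedPoints_top_of_forall fun σ =>
    ThetaSetting.KummerCore.smul_eq_of_coe_mem (ThetaSetting.modelχq p i j hj).Kdd (unitχq p i j hj u)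
      (u : (ThetaSetting.modelχq p i j hj).Kdd).2 σ (by
        change σ ∈ (fieldKN ⊥ (qModel p) 2).fixingSubgroup
        rw [fixingSubgroup_fieldKN_qModel_two_eq_top]; exact Subgroup.mem_top σ)

/-- **`κ_u : G_{ℚ_p} → Ẑ`** at the stage-2 model (root system `RootSystem.ofRootableBy u`). [cite: MochizukiEtTh2009, Prop 1.5 p.23] -/
def kappaUnitχq (hj : Even j) (u : (↥(ThetaSetting.modelχq p i j hj).Kdd)ˣ) : GQp p → ZH :=
  kummerZH (RootSystem.ofRootableBy (unitχq p i j hj u)) (unitχq_mem_fixedPoints p i j hj u)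

/-- [cite: MochizukiEtTh2009, Prop 1.5 p.23] -/
theorem kappaUnitχq_def (hj : Even j) (u : (↥(ThetaSetting.modelχq p i j hj).Kdd)ˣ) (σ : GQp p) :
    kappaUnitχq p i j hj u σ =
      kummerZH (RootSystem.ofRootableBy (unitχq p i j hj u)) (unitχq_mem_fixedPoints p i j hj u) σ := rfl

/-- `κ_u` is a `χ`-cocycle. [cite: MochizukiEtTh2009, Prop 1.5 p.23] -/
theorem kappaUnitχq_mul (hj : Even j) (u : (↥(ThetaSetting.modelχq p i j hj).Kdd)ˣ) (σ τ : GQp p) :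
    kappaUnitχq p i j hj u (σ * τ) = kappaUnitχq p i j hj u σ * chi p σ (kappaUnitχq p i j hj u τ) :=
  kummerZH_mul _ _ σ τ

/-- `κ_u²` is a `χ`-cocycle. [cite: MochizukiEtTh2009, Prop 1.5 p.23] -/
theorem kappaUnitχq_sq_mul (hj : Even j) (u : (↥(ThetaSetting.modelχq p i j hj).Kdd)ˣ) (σ τ : GQp p) :
    (kappaUnitχq p i j hj u * kappaUnitχq p i j hj u) (σ * τ) =
      (kappaUnitχq p i j hj u * kappaUnitχq p i j hj u) σ *
        chi p σ ((kappaUnitχq p i j hj u * kappaUnitχq p i j hj u) τ) :=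
  chiCocycle_mul (kappaUnitχq_mul p i j hj u) (kappaUnitχq_mul p i j hj u) σ τ

/-- `κ_u` is continuous. [cite: MochizukiEtTh2009, Prop 1.5 p.23] -/
theorem continuous_kappaUnitχq (hj : Even j) (u : (↥(ThetaSetting.modelχq p i j hj).Kdd)ˣ) :
    Continuous (kappaUnitχq p i j hj u) :=
  continuous_kummerZH p _ _

/-- **The `κ_u²`-twisted section of the stage-2 augmentation.** [cite: MochizukiEtTh2009, Def 1.9 p.29] -/
def sectionOfUnitχq (hj : Even j) (u : (↥(ThetaSetting.modelχq p i j hj).Kdd)ˣ) : GQp p →* PiTpχq p i j :=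
  sectionχq p i j (kappaUnitχq p i j hj u * kappaUnitχq p i j hj u) (kappaUnitχq_sq_mul p i j hj u)

/-- It is continuous. [cite: MochizukiEtTh2009, Def 1.9 p.29] -/
theorem continuous_sectionOfUnitχq (hj : Even j) (u : (↥(ThetaSetting.modelχq p i j hj).Kdd)ˣ) :
    Continuous (sectionOfUnitχq p i j hj u) :=
  continuous_sectionχq p i j _ _ ((continuous_kappaUnitχq p i j hj u).mul (continuous_kappaUnitχq p i j hj u))

/-- It is a section of the augmentation. [cite: MochizukiEtTh2009, Def 1.9 p.29] -/
theorem aug_modelχq_sectionOfUnitχq (hj : Even j) (u : (↥(ThetaSetting.modelχq p i j hj).Kdd)ˣ) (σ : GQp p) :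
    (ThetaSetting.modelχq p i j hj).aug (sectionOfUnitχq p i j hj u σ) = σ := rfl

/-- It lands in `Π^tp_Ÿ`. [cite: MochizukiEtTh2009, Def 1.9 p.29] -/
theorem map_sectionOfUnitχq_GKdd_le_GtpYdd (hj : Even j) (u : (↥(ThetaSetting.modelχq p i j hj).Kdd)ˣ) :
    (ThetaSetting.modelχq p i j hj).GKdd.map (sectionOfUnitχq p i j hj u) ≤ (ThetaSetting.modelχq p i j hj).GtpYdd :=
  map_sectionχq_sq_GKdd_le_GtpYdd_modelχq p i j hj (kappaUnitχq_sq_mul p i j hj u)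

/-- **`ŷ = κ_u²` along the twisted section.** [cite: MochizukiEtTh2009, Prop 1.5 p.23] -/
theorem yThetaχq_toTheta_sectionOfUnitχq (hj : Even j) (u : (↥(ThetaSetting.modelχq p i j hj).Kdd)ˣ) (σ : GQp p) :
    yThetaχq p i j ((ThetaSetting.modelχq p i j hj).toTheta (sectionOfUnitχq p i j hj u σ)) =
      kappaUnitχq p i j hj u σ * kappaUnitχq p i j hj u σ := by
  show eHatB (gfpFst (sectionχq p i j _ (kappaUnitχq_sq_mul p i j hj u) σ).left) = _
  rw [sectionχq_left, gfpFst_bPowGfp, eHatB_bPow]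
  rfl

/-! ### The anchor `log(Ü)|_y = Ü(y)` and anchored points at the stage-2 model -/

section OfSection

variable (hj : Even j) (s : GQp p →* (ThetaSetting.modelχq p i j hj).PiTemp) (hs : Continuous s)
  (hsec : ∀ σ : GQp p, (ThetaSetting.modelχq p i j hj).aug (s σ) = σ)
  (hsY : (ThetaSetting.modelχq p i j hj).GK.map s ≤ (ThetaSetting.modelχq p i j hj).GtpY)
  (hsYdd : (ThetaSetting.modelχq p i j hj).GKdd.map s ≤ (ThetaSetting.modelχq p i j hj).GtpYdd)

include hsec in
/-- **The ANCHOR hypothesis HOLDS at the `κ_u²`-twisted section of the stage-2 model**: the core's `log(Ü) = c^{ŷ/2}`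
pulls back along `sectionOfUnitχq u` to the Kummer class `κ(u)` of the section datum of ANY base section `s`,
presented through `sectionOfUnitχq u` — on the nose at cocycle level (`ŷ/2 = κ_u` along the section; the core's
Kummer cocycle at `θ(s σ)` is `(σ(u^{1/N})/u^{1/N})_N` since `aug ∘ s = id`). [cite: MochizukiEtTh2009, Prop 1.4 (iii) p.22] -/
theorem comap_sectionOfUnitχq_logUdd (u : (↥(ThetaSetting.modelχq p i j hj).Kdd)ˣ) :
    ContH1.comap (ThetaSetting.modelχq p i j hj).toTheta (ThetaSetting.modelχq p i j hj).DeltaTheta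
        (sectionOfUnitχq p i j hj u) (continuous_sectionOfUnitχq p i j hj u)
        (map_sectionOfUnitχq_GKdd_le_GtpYdd p i j hj u)
        ((ThetaSetting.modelχq p i j hj).inflTheta (ThetaSetting.modelχq p i j hj).GtpYdd
          (kummerCoreχq p i j hj).logUdd) =
      (kummerCoreχq p i j hj).sectionPresentation s hs hsec hsY hsYdd (sectionOfUnitχq p i j hj u)
        (aug_modelχq_sectionOfUnitχq p i j hj u)
        ((kummerCoreχq p i j hj).toKddHatOfSection s hs hsYdd u) := by
  letI := (ThetaSetting.modelχq p i j hj).unitsAction (kummerCoreχq p i j hj).augTheta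
  change ContH1.mk _ _ = ContH1.mk _ _
  refine ContH1.mk_congr _ (funext fun x => ?_) _ _
  change deltaThetaCoordχq p i j (half ⟨yThetaχq p i j ((ThetaSetting.modelχq p i j hj).toTheta
      (sectionOfUnitχq p i j hj u x.1)), _⟩) =
    deltaThetaCoordχq p i j (cycEquiv p ((RootSystem.ofRootableBy (unitχq p i j hj u)).kummerCocycle _
      ⟨(ThetaSetting.modelχq p i j hj).toTheta (s x.1), _⟩))
  congr 1
  have hy : half ⟨yThetaχq p i j ((ThetaSetting.modelχq p i j hj).toTheta (sectionOfUnitχq p i j hj u x.1)),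
      (yCoordKitχq p i j hj).y_even _ ⟨sectionOfUnitχq p i j hj u x.1,
        map_sectionOfUnitχq_GKdd_le_GtpYdd p i j hj u ⟨x.1, x.2, rfl⟩, rfl⟩⟩ = kappaUnitχq p i j hj u x.1 := by
    apply sqHom_injective
    rw [sqHom_apply, sqHom_apply, half_sq, pow_two]
    exact yThetaχq_toTheta_sectionOfUnitχq p i j hj u x.1
  rw [hy, kappaUnitχq_def, kummerZH_def]
  congr 1
  refine Subtype.ext (funext fun n => ?_)
  simp only [RootSystem.kummerCocycle_apply, Subgroup.smul_def]
  change (x.1 : GQp p) • (RootSystem.ofRootableBy (unitχq p i j hj u)).root n / _ =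
    (kummerCoreχq p i j hj).augTheta ((ThetaSetting.modelχq p i j hj).toTheta (s x.1)) •
      (RootSystem.ofRootableBy (unitχq p i j hj u)).root n / _
  rw [(kummerCoreχq p i j hj).augTheta_toTheta_section s hsec]

/-- **An ANCHORED `K̈`-point of `Ÿ` at the stage-2 model** with prescribed coordinate `u` off the cusps, for the section
datum of any base section `s`: `D_y := sectionOfUnitχq u (G_{ℚ_p})`, `Ü(y) := u`, `log(Ü)|_y = u`.
[cite: MochizukiEtTh2009, Prop 1.4 (iii) p.22] -/
def anchoredPointχqOfSection (u : (↥(ThetaSetting.modelχq p i j hj).Kdd)ˣ)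
    (hu : ∀ a : ℤ, ((u : (ThetaSetting.modelχq p i j hj).Kdd) : PadicAlgCl p) ≠ (ThetaSetting.modelχq p i j hj).qdd ^ a ∧
      ((u : (ThetaSetting.modelχq p i j hj).Kdd) : PadicAlgCl p) ≠ -((ThetaSetting.modelχq p i j hj).qdd ^ a)) :
    ThetaSetting.AnchoredPoint ((kummerCoreχq p i j hj).toKummerDataOfSection s hs hsec hsY hsYdd) :=
  (kummerCoreχq p i j hj).anchoredPointOfSections s hs hsec hsY hsYdd (sectionOfUnitχq p i j hj u)
    (continuous_sectionOfUnitχq p i j hj u) (aug_modelχq_sectionOfUnitχq p i j hj u)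
    (map_sectionOfUnitχq_GKdd_le_GtpYdd p i j hj u) u hu (comap_sectionOfUnitχq_logUdd p i j hj s hs hsec hsY hsYdd u)

/-- Its coordinate is `u`. [cite: MochizukiEtTh2009, Prop 1.4 (iii) p.22] -/
theorem coord_anchoredPointχqOfSection (u : (↥(ThetaSetting.modelχq p i j hj).Kdd)ˣ)
    (hu : ∀ a : ℤ, ((u : (ThetaSetting.modelχq p i j hj).Kdd) : PadicAlgCl p) ≠ (ThetaSetting.modelχq p i j hj).qdd ^ a ∧
      ((u : (ThetaSetting.modelχq p i j hj).Kdd) : PadicAlgCl p) ≠ -((ThetaSetting.modelχq p i j hj).qdd ^ a)) :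
    (anchoredPointχqOfSection p i j hj s hs hsec hsY hsYdd u hu).coord = u := rfl

/-- **CENSUS: `AnchoredPoint → WITNESSED at modelχq`** (section datum of any Galois section `s`; coordinate `1 + p`,
abc-iut-L2-t6's `onePlusP`, off the cusps — `K̈(modelχq) = K̈(modelχ) = ℚ_p`). [cite: MochizukiEtTh2009, Prop 1.4 (iii) p.22] -/
theorem nonempty_anchoredPoint_modelχq_ofSection :
    Nonempty (ThetaSetting.AnchoredPoint ((kummerCoreχq p i j hj).toKummerDataOfSection s hs hsec hsY hsYdd)) :=
  ⟨anchoredPointχqOfSection p i j hj s hs hsec hsY hsYdd (onePlusP p) (onePlusP_ne_cusp p)⟩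

/-- **CENSUS: `NonCuspidalPoint → WITNESSED at modelχq`** (section datum of any `s`; the base section itself as
`D_y`, coordinate `1 + p`). [cite: MochizukiEtTh2009, Prop 1.4 (iii) p.22] -/
theorem nonempty_nonCuspidalPoint_modelχq_ofSection :
    Nonempty (ThetaSetting.NonCuspidalPoint ((kummerCoreχq p i j hj).toKummerDataOfSection s hs hsec hsY hsYdd)) :=
  ⟨(kummerCoreχq p i j hj).nonCuspidalPointOfCoreSection s hs hsec hsY hsYdd (onePlusP p) (onePlusP_ne_cusp p)⟩

end OfSection

/-- **CENSUS: `EtaleThetaData → WITNESSED at modelχq`** (abc-iut-w5-d171's Kummer datum + F7a's degenerate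
`½`-groups). [cite: MochizukiEtTh2009, Prop 1.3 p.20] -/
theorem nonempty_etaleThetaData_modelχq (hj : Even j) : Nonempty (ThetaSetting.modelχq p i j hj).EtaleThetaData :=
  ThetaSetting.nonempty_etaleThetaData_of_nonempty_kummerData (nonempty_kummerData_modelχq p i j hj)

end Literature.AnabelianGeometry.EtaleTheta.SettingModel

end
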